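import Mathlib.Analysis.MellinInversion
import Literature.NumberTheory.LFunctions.VonMangoldtLaplaceProgressions
import Literature.NumberTheory.LFunctions.RHInvZetaBound
import Literature.NumberTheory.LFunctions.DirichletLFunctionBounds
import Literature.NumberTheory.LFunctions.MertensBoundRH
import Literature.Analysis.SpecialFunctions.GammaVerticalBounds
import HarnessLib

/-!
# `∑_{n ≡ a (q)} Λ(n) e^{-nt} − e^{-t}/(φ(q)t) = O(t^{-B-ε})` under a zero-free half-plane `Re s > B`

Support file (everything PROVED, no definitions, no named facts) completing the discharge of
`Literature.Barriers.Parity.BHMS2019_thm1_ii` (Bhowmik–Halupczok–Matsumoto–Suzuki, Mathematika 65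
(2019), Theorem 1 (2)): it proves the a-priori bound that is the hypothesis of
`Literature.Barriers.Parity.BHMS2019_thm1_ii_of_laplaceBound`
(`Literature/Barriers/Parity/GoldbachAverageZerosProofs.lean`), namely

* `laplaceBound_of_zeroFree`: for `q ≥ 1`, an invertible residue `a`, and `1/2 ≤ B < μ`, if all
  `L(·, χ)` (`χ mod q`) are zero-free on `B < Re s < 1`, then
  `|E_a(t)| ≤ K t^{-μ}` on `(0, 1]`, where `E_a(t) = ∑_{n ≡ a} Λ(n)e^{-nt} − e^{-t}/(φ(q)t)`.

This is the Laplace-transform form of the classical "quasi-GRH `⇒ ψ(x; q, a) = x/φ(q) + O(x^{B+ε})`"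
and is proved the classical way, from Mathlib and the tree:

* `norm_Gamma_le_const`, `norm_Gamma_le_div_cube`, `norm_Gamma_mul_le` — `|Γ(σ+iy)| ≤ 120` and
  `≤ 120/|y|³` on `1/2 ≤ σ ≤ 3` (tree `Literature.Analysis.SpecialFunctions.GammaVert.norm_Gamma_le_Gamma_re`,
  convexity of `Γ`, `Γ(s) = Γ(s+3)/(s(s+1)(s+2))`);
* `norm_logDeriv_le_of_ball` — Borel–Carathéodory (Mathlib `Complex.borelCaratheodory`) plus
  Cauchy's estimate for the logarithmic derivative of a zero-free holomorphic function on a disc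
  (holomorphic logarithm from `Literature.NumberTheory.LFunctions.InvZetaRH.exists_log_of_ball`);
* `norm_LFunction_le_uniform` — `‖L(z, χ)‖ ≤ C_q ‖z‖` on `Re z > 1/2`, `|Im z| ≥ 1`, all `χ`
  (tree `DirichletZFR.norm_LFunction_le_of_re_ge` for `χ ≠ 1`; `ζ(z)∏(1 − p^{-z})` and
  `InvZetaRH.norm_riemannZeta_le_three_mul` for `χ = 1`);
* `norm_logDeriv_LFunction_le` — in the zero-free region, `‖L'/L(σ+iy, χ)‖ ≪_{q,μ,B} 4 + |y|` for
  `μ ≤ σ ≤ 3`, `|y| ≥ 4`;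
* `exists_norm_LFunctionResidueClassAux_le` — hence Mathlib's continued
  `LFunctionResidueClassAux a` (`= L(Λ_a, s) − φ⁻¹/(s−1)`) is `≪ 4 + |Im s|` on the strip
  `μ ≤ Re s ≤ 3` (compactness for `|Im s| ≤ 4`), and holomorphic there
  (`differentiableAt_LFunctionResidueClassAux`);
* `abs_errLaplace_le_of_strip_bound` — Mellin inversion on `Re s = 3` (Mathlib
  `mellinInv_mellin_eq`; the Mellin transform of `E_a` is `Γ(s) · Aux_a(s)`,
  `Literature.NumberTheory.LFunctions.LaplaceProgressions.mellin_errLaplace`) and the shift of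
  the line of integration to `Re s = μ`
  (`Literature.NumberTheory.LFunctions.MertensBoundRH.integral_vertical_eq_of_tendsto`);
* `abs_errLaplace_le_inv` — unconditionally `E_a(t) = O(1/t)` (Mathlib's Chebyshev bound
  `Chebyshev.psi_le_const_mul_self`, summed by parts), covering the vacuous case `B ≥ 1`.

## References

* G. Bhowmik, K. Halupczok, K. Matsumoto, Y. Suzuki, Mathematika 65 (2019), 57–97,
  arXiv:1704.06103, Theorem 1 (2) (the target) and §7.
* E. C. Titchmarsh, *The Theory of the Riemann Zeta-Function*, 2nd ed. (1986), §3.9 and §14.2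
  (Borel–Carathéodory bounds for logarithmic derivatives in zero-free regions).
* H. L. Montgomery, R. C. Vaughan, *Multiplicative Number Theory I*, CUP 2007, §5.1 (Mellin
  inversion for smoothed sums).
-/

noncomputable section

open Filter Asymptotics MeasureTheory Set Complex Metric
open scoped Topology Real

namespace Literature.NumberTheory.LFunctions

namespace LaplaceProgressions

/-! ### Vertical bounds for `Γ` on `1/2 ≤ Re s ≤ 3` -/

/-- `Γ(x) ≤ 120` for `1/2 ≤ x ≤ 6` (convexity of `Γ`, `Γ(1/2) = √π`, `Γ(6) = 120`). [folklore] -/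
theorem Real_Gamma_le {x : ℝ} (h1 : 1 / 2 ≤ x) (h6 : x ≤ 6) : Real.Gamma x ≤ 120 := by
  have hseg : x ∈ segment ℝ (1 / 2 : ℝ) 6 := by
    rw [segment_eq_Icc (by norm_num)]; exact ⟨h1, h6⟩
  have h := Real.convexOn_Gamma.le_on_segment (by norm_num : (1 / 2 : ℝ) ∈ Set.Ioi 0)
    (by norm_num : (6 : ℝ) ∈ Set.Ioi 0) hseg
  have hhalf : Real.Gamma (1 / 2) ≤ 120 := by
    rw [Real.Gamma_one_half_eq]
    have h4 : Real.sqrt π ≤ Real.sqrt 4 := Real.sqrt_le_sqrt Real.pi_lt_four.le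
    have : Real.sqrt 4 = 2 := by
      rw [show (4 : ℝ) = 2 ^ 2 by norm_num, Real.sqrt_sq (by norm_num)]
    linarith
  have h6' : Real.Gamma 6 ≤ 120 := by
    rw [Real.Gamma_ofNat_eq_factorial 5]
    simp [Nat.factorial]
  exact h.trans (max_le hhalf h6')

/-- `‖Γ(σ + iy)‖ ≤ 120` for `1/2 ≤ σ ≤ 6`. [folklore] -/
theorem norm_Gamma_le_const {σ : ℝ} (h1 : 1 / 2 ≤ σ) (h6 : σ ≤ 6) (y : ℝ) :
    ‖Complex.Gamma (σ + y * I)‖ ≤ 120 :=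
  (Literature.Analysis.SpecialFunctions.GammaVert.norm_Gamma_le_Gamma_re (by linarith) y).trans
    (Real_Gamma_le h1 h6)

/-- Polynomial decay on vertical lines: for `1/2 ≤ σ ≤ 3` and `y ≠ 0`,
`‖Γ(σ + iy)‖ ≤ 120/|y|³` (from `Γ(s) = Γ(s+3)/(s(s+1)(s+2))`). [folklore] -/
theorem norm_Gamma_le_div_cube {σ : ℝ} (h1 : 1 / 2 ≤ σ) (h3 : σ ≤ 3) {y : ℝ} (hy : y ≠ 0) :
    ‖Complex.Gamma (σ + y * I)‖ ≤ 120 / |y| ^ 3 := by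
  set s : ℂ := σ + y * I with hs
  have him : ∀ k : ℕ, (s + k).im = y := fun k ↦ by simp [hs]
  have hne : ∀ k : ℕ, s + k ≠ 0 := fun k h ↦ by
    have := him k; rw [h] at this; simp at this; exact hy this.symm
  have hnorm : ∀ k : ℕ, |y| ≤ ‖s + k‖ := fun k ↦ by
    have := abs_im_le_norm (s + k); rwa [him k] at this
  have h0 : s ≠ 0 := by simpa using hne 0
  have h1' : s + 1 ≠ 0 := by simpa using hne 1
  have h2' : s + 2 ≠ 0 := by simpa using hne 2
  have hΓ : Complex.Gamma (s + 3) = (s + 2) * ((s + 1) * (s * Complex.Gamma s)) := by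
    rw [show s + 3 = s + 2 + 1 by ring, Complex.Gamma_add_one _ h2', show s + 2 = s + 1 + 1 by ring,
      Complex.Gamma_add_one _ h1', Complex.Gamma_add_one _ h0]
  have hΓ3 : ‖Complex.Gamma (s + 3)‖ ≤ 120 := by
    have : s + 3 = ((σ + 3 : ℝ) : ℂ) + y * I := by simp [hs]; ring
    rw [this]
    exact norm_Gamma_le_const (by linarith) (by linarith) y
  have hy0 : 0 < |y| := abs_pos.mpr hy
  have hprod : |y| ^ 3 * ‖Complex.Gamma s‖ ≤ ‖Complex.Gamma (s + 3)‖ := by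
    rw [hΓ, norm_mul, norm_mul, norm_mul]
    have hy2 : |y| ≤ ‖s + 2‖ := by simpa using hnorm 2
    have hy1 : |y| ≤ ‖s + 1‖ := by simpa using hnorm 1
    have hy0' : |y| ≤ ‖s‖ := by simpa using hnorm 0
    calc |y| ^ 3 * ‖Complex.Gamma s‖ = |y| * (|y| * (|y| * ‖Complex.Gamma s‖)) := by ring
      _ ≤ ‖s + 2‖ * (‖s + 1‖ * (‖s‖ * ‖Complex.Gamma s‖)) := by gcongr
  rw [le_div_iff₀ (by positivity)]
  calc ‖Complex.Gamma s‖ * |y| ^ 3 = |y| ^ 3 * ‖Complex.Gamma s‖ := mul_comm _ _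
    _ ≤ ‖Complex.Gamma (s + 3)‖ := hprod
    _ ≤ 120 := hΓ3

/-- A convenient combined bound: for `1/2 ≤ σ ≤ 3`, `‖Γ(σ+iy)‖ (4 + |y|) ≤ 2400 (1 + y²)⁻¹`.
[folklore] -/
theorem norm_Gamma_mul_le {σ : ℝ} (h1 : 1 / 2 ≤ σ) (h3 : σ ≤ 3) (y : ℝ) :
    ‖Complex.Gamma (σ + y * I)‖ * (4 + |y|) ≤ 2400 * (1 + y ^ 2)⁻¹ := by
  rcases le_or_gt |y| 1 with hy | hy
  · have hΓ := norm_Gamma_le_const h1 (by linarith) y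
    have hy2 : y ^ 2 ≤ 1 := by nlinarith [abs_nonneg y, sq_abs y]
    rw [← div_eq_mul_inv, le_div_iff₀ (by positivity)]
    calc ‖Complex.Gamma (σ + y * I)‖ * (4 + |y|) * (1 + y ^ 2) ≤ 120 * (4 + 1) * (1 + 1) := by
          gcongr
      _ ≤ 2400 := by norm_num
  · have hy0 : y ≠ 0 := fun h ↦ by rw [h] at hy; simp at hy; linarith
    have hΓ := norm_Gamma_le_div_cube h1 h3 hy0
    have hypos : 0 < |y| := by linarith
    rw [← div_eq_mul_inv, le_div_iff₀ (by positivity)]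
    calc ‖Complex.Gamma (σ + y * I)‖ * (4 + |y|) * (1 + y ^ 2)
        ≤ 120 / |y| ^ 3 * (4 + |y|) * (1 + y ^ 2) := by gcongr
      _ ≤ 120 / |y| ^ 3 * (5 * |y|) * (2 * |y| ^ 2) := by
          rw [← sq_abs y]; gcongr <;> nlinarith
      _ = 1200 := by field_simp; norm_num
      _ ≤ 2400 := by norm_num

/-! ### Borel–Carathéodory bound for a logarithmic derivative on a disc -/

/-- **Borel–Carathéodory bound for `f'/f`.** Let `f` be holomorphic and zero-free on the disc
`‖z − c‖ < R` with `‖f‖ ≤ e^M` there (`M > 0`), and let `0 < r < R`. Then for `‖z − c‖ ≤ r`,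
`‖f'(z)/f(z)‖ ≤ (2M R' + ‖log f(c)‖ (R + R')) / ((R − R') δ)` with `δ = (R − r)/2`, `R' = r + δ`:
Borel–Carathéodory (Mathlib `Complex.borelCaratheodory`) for the holomorphic logarithm `L` of `f`
with `L(c) = log f(c)` (`Literature.NumberTheory.LFunctions.InvZetaRH.exists_log_of_ball`;
`Re L = log ‖f‖ ≤ M`) on `‖z − c‖ ≤ R'`, then Cauchy's estimate for `L' = f'/f` on the circle
of radius `δ`. [folklore] -/
theorem norm_logDeriv_le_of_ball {f : ℂ → ℂ} {c : ℂ} {R r M : ℝ} (hr : 0 < r) (hrR : r < R)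
    (hf : DifferentiableOn ℂ f (ball c R)) (hf0 : ∀ z ∈ ball c R, f z ≠ 0) (hM : 0 < M)
    (hfM : ∀ z ∈ ball c R, ‖f z‖ ≤ Real.exp M) {z : ℂ} (hz : ‖z - c‖ ≤ r) :
    ‖deriv f z / f z‖ ≤ (2 * M * (r + (R - r) / 2) + ‖log (f c)‖ * (R + (r + (R - r) / 2))) /
      ((R - (r + (R - r) / 2)) * ((R - r) / 2)) := by
  have hR : 0 < R := hr.trans hrR
  set δ : ℝ := (R - r) / 2 with hδ
  set R' : ℝ := r + δ with hR'
  have hδ0 : 0 < δ := by rw [hδ]; linarith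
  have hR'R : R' < R := by rw [hR', hδ]; linarith
  have hRR' : R - R' = δ := by rw [hR', hδ]; ring
  obtain ⟨L, hLd, hLc, hLder, hexp⟩ := InvZetaRH.exists_log_of_ball hR hf hf0
  -- Borel–Carathéodory for `L` on the closed disc of radius `R'`
  have hBC : ∀ w : ℂ, ‖w - c‖ ≤ R' →
      ‖L w‖ ≤ 2 * M * R' / (R - R') + ‖log (f c)‖ * (R + R') / (R - R') := by
    intro w hw
    set f₀ : ℂ → ℂ := fun u ↦ L (c + u) with hf₀
    have hshift : ∀ u ∈ ball (0 : ℂ) R, c + u ∈ ball c R := by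
      intro u hu
      rw [mem_ball_zero_iff] at hu
      rwa [mem_ball, dist_eq_norm, add_sub_cancel_left]
    have hf₀d : DifferentiableOn ℂ f₀ (ball 0 R) := by
      intro u hu
      exact ((hLd.differentiableAt (isOpen_ball.mem_nhds (hshift u hu))).comp u
        ((differentiableAt_const c).add differentiableAt_id)).differentiableWithinAt
    have hmaps : MapsTo f₀ (ball 0 R) {u | u.re ≤ M} := by
      intro u hu
      have hcu := hshift u hu
      show (L (c + u)).re ≤ M
      have hre : (L (c + u)).re = Real.log ‖f (c + u)‖ := by
        rw [← hexp _ hcu, norm_exp, Real.log_exp]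
      rw [hre]
      have hpos : 0 < ‖f (c + u)‖ := norm_pos_iff.mpr (hf0 _ hcu)
      calc Real.log ‖f (c + u)‖ ≤ Real.log (Real.exp M) := Real.log_le_log hpos (hfM _ hcu)
        _ = M := Real.log_exp M
    have hu : w - c ∈ ball (0 : ℂ) R := by
      rw [mem_ball_zero_iff]; exact hw.trans_lt hR'R
    have key := borelCaratheodory hM hf₀d hmaps hR hu
    have hf₀w : f₀ (w - c) = L w := by simp [hf₀]
    have hf₀0 : f₀ 0 = log (f c) := by simp only [hf₀, add_zero]; exact hLc
    rw [hf₀w, hf₀0] at key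
    have hden : R - R' ≤ R - ‖w - c‖ := by linarith
    have hdenpos : 0 < R - R' := by linarith
    have h1 : 2 * M * ‖w - c‖ / (R - ‖w - c‖) ≤ 2 * M * R' / (R - R') :=
      div_le_div₀ (by positivity) (by gcongr) hdenpos hden
    have h2 : ‖log (f c)‖ * (R + ‖w - c‖) / (R - ‖w - c‖) ≤ ‖log (f c)‖ * (R + R') / (R - R') :=
      div_le_div₀ (by positivity) (by gcongr) hdenpos hden
    exact key.trans (add_le_add h1 h2)
  -- Cauchy's estimate for `L'` on the circle of radius `δ` about `z`
  have hzc : closedBall z δ ⊆ ball c R := by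
    intro w hw
    rw [mem_closedBall, dist_eq_norm] at hw
    rw [mem_ball, dist_eq_norm]
    calc ‖w - c‖ = ‖(w - z) + (z - c)‖ := by ring_nf
      _ ≤ ‖w - z‖ + ‖z - c‖ := norm_add_le _ _
      _ ≤ δ + r := add_le_add hw hz
      _ = R' := by rw [hR']; ring
      _ < R := hR'R
  have hzball : z ∈ ball c R := hzc (mem_closedBall_self hδ0.le)
  have hdcc : DiffContOnCl ℂ L (ball z δ) := hLd.diffContOnCl_ball hzc
  have hsphere : ∀ w ∈ sphere z δ,
      ‖L w‖ ≤ 2 * M * R' / (R - R') + ‖log (f c)‖ * (R + R') / (R - R') := by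
    intro w hw
    refine hBC w ?_
    rw [mem_sphere, dist_eq_norm] at hw
    calc ‖w - c‖ = ‖(w - z) + (z - c)‖ := by ring_nf
      _ ≤ ‖w - z‖ + ‖z - c‖ := norm_add_le _ _
      _ ≤ δ + r := add_le_add hw.le hz
      _ = R' := by rw [hR']; ring
  have hCauchy := norm_deriv_le_of_forall_mem_sphere_norm_le hδ0 hdcc hsphere
  rw [(hLder z hzball).deriv] at hCauchy
  rw [hRR']
  convert hCauchy using 1
  rw [hRR']
  field_simp

/-! ### Bounds for `L(z, χ)` on `Re z > 1/2`, `|Im z| ≥ 1` -/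

section LBounds

variable {q : ℕ} [NeZero q]

omit [NeZero q] in
/-- `‖∏_{p ∣ q}(1 − p^{-z})‖ ≤ 2^{ω(q)}` for `Re z ≥ 0`. [folklore] -/
theorem norm_prod_one_sub_cpow_le {z : ℂ} (hz : 0 ≤ z.re) :
    ‖∏ p ∈ q.primeFactors, (1 - (p : ℂ) ^ (-z))‖ ≤ 2 ^ q.primeFactors.card := by
  calc ‖∏ p ∈ q.primeFactors, (1 - (p : ℂ) ^ (-z))‖
      ≤ ∏ p ∈ q.primeFactors, ‖1 - (p : ℂ) ^ (-z)‖ := Finset.norm_prod_le _ _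
    _ ≤ ∏ _p ∈ q.primeFactors, (2 : ℝ) := by
        refine Finset.prod_le_prod (fun _ _ ↦ norm_nonneg _) fun p hp ↦ ?_
        have hpp := Nat.prime_of_mem_primeFactors hp
        calc ‖1 - (p : ℂ) ^ (-z)‖ ≤ ‖(1 : ℂ)‖ + ‖(p : ℂ) ^ (-z)‖ := norm_sub_le _ _
          _ = 1 + (p : ℝ) ^ (-z.re) := by
              rw [norm_one, Complex.norm_natCast_cpow_of_pos hpp.pos, neg_re]
          _ ≤ 1 + 1 := by
              gcongr
              exact Real.rpow_le_one_of_one_le_of_nonpos (by exact_mod_cast hpp.one_lt.le)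
                (by linarith)
          _ = 2 := by norm_num
    _ = 2 ^ q.primeFactors.card := by simp

omit [NeZero q] in
/-- The constant `C_q = q ∑ n^{-5/4} + 3 · 2^{ω(q)}` of the uniform bound `‖L(z, χ)‖ ≤ C_q ‖z‖`.
It is at least `3`. [folklore] -/
theorem three_le_LConst :
    (3 : ℝ) ≤ q * (∑' n : ℕ, ((n + 1 : ℕ) : ℝ) ^ (-(5 / 4 : ℝ))) + 3 * 2 ^ q.primeFactors.card := by
  have h1 : (0 : ℝ) ≤ q * ∑' n : ℕ, ((n + 1 : ℕ) : ℝ) ^ (-(5 / 4 : ℝ)) := by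
    have := DirichletZFR.one_le_tsum_rpow; positivity
  have h2 : (1 : ℝ) ≤ 2 ^ q.primeFactors.card := one_le_pow₀ (by norm_num)
  linarith

/-- **Uniform polynomial bound:** for every `χ (mod q)` and `Re z > 1/2`, `|Im z| ≥ 1`,
`‖L(z, χ)‖ ≤ C_q ‖z‖` (`χ ≠ 1`: the tree's crude MV Lemma 10.15,
`Literature.NumberTheory.LFunctions.DirichletZFR.norm_LFunction_le_of_re_ge`; `χ = 1`: `L(z, 1) = ζ(z) ∏_{p ∣ q}(1 − p^{-z})`
and `‖ζ(z)‖ ≤ 3‖z‖`). [folklore] -/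
theorem norm_LFunction_le_uniform (χ : DirichletCharacter ℂ q) {z : ℂ} (hz : 1 / 2 < z.re)
    (hzi : 1 ≤ |z.im|) :
    ‖χ.LFunction z‖ ≤ (q * (∑' n : ℕ, ((n + 1 : ℕ) : ℝ) ^ (-(5 / 4 : ℝ))) +
      3 * 2 ^ q.primeFactors.card) * ‖z‖ := by
  have hZ : (0 : ℝ) ≤ q * ∑' n : ℕ, ((n + 1 : ℕ) : ℝ) ^ (-(5 / 4 : ℝ)) := by
    have := DirichletZFR.one_le_tsum_rpow; positivity
  have hω : (0 : ℝ) ≤ 3 * 2 ^ q.primeFactors.card := by positivity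
  rcases eq_or_ne χ 1 with rfl | hχ
  · have hz1 : z ≠ 1 := by
      intro h; rw [h] at hzi; simp at hzi; linarith
    have : (1 : DirichletCharacter ℂ q).LFunction z = DirichletCharacter.LFunctionTrivChar q z := rfl
    rw [this, DirichletCharacter.LFunctionTrivChar_eq_mul_riemannZeta hz1, norm_mul]
    calc ‖∏ p ∈ q.primeFactors, (1 - (p : ℂ) ^ (-z))‖ * ‖riemannZeta z‖
        ≤ 2 ^ q.primeFactors.card * (3 * ‖z‖) :=
          mul_le_mul (norm_prod_one_sub_cpow_le (by linarith))
            (InvZetaRH.norm_riemannZeta_le_three_mul hz hzi) (norm_nonneg _) (by positivity)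
      _ = 3 * 2 ^ q.primeFactors.card * ‖z‖ := by ring
      _ ≤ _ := by nlinarith [norm_nonneg z]
  · have h := DirichletZFR.norm_LFunction_le_of_re_ge χ hχ (by linarith : 1 / 4 ≤ z.re)
    calc ‖χ.LFunction z‖ ≤ q * ‖z‖ * ∑' n : ℕ, ((n + 1 : ℕ) : ℝ) ^ (-(5 / 4 : ℝ)) := h
      _ = q * (∑' n : ℕ, ((n + 1 : ℕ) : ℝ) ^ (-(5 / 4 : ℝ))) * ‖z‖ := by ring
      _ ≤ _ := by nlinarith [norm_nonneg z]

omit [NeZero q] in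
/-- `‖log w‖ ≤ |log ‖w‖| + π` for the principal logarithm. [folklore] -/
theorem norm_log_le_abs_log_add_pi (w : ℂ) : ‖log w‖ ≤ |Real.log ‖w‖| + π := by
  calc ‖log w‖ ≤ |(log w).re| + |(log w).im| := Complex.norm_le_abs_re_add_abs_im _
    _ = |Real.log ‖w‖| + |arg w| := by rw [Complex.log_re, Complex.log_im]
    _ ≤ |Real.log ‖w‖| + π := by gcongr; exact Complex.abs_arg_le_pi w

/-- At the centre `c = 2 + iy` (`|y| ≥ 1`): `‖log L(c, χ)‖ ≤ log(C_q ‖c‖) + 5`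
(`1/2 ≤ ‖L(c, χ)‖ ≤ C_q‖c‖`). [folklore] -/
theorem norm_log_LFunction_center_le (χ : DirichletCharacter ℂ q) {y : ℝ} (hy : 1 ≤ |y|) :
    ‖log (χ.LFunction (2 + y * I))‖ ≤
      Real.log ((q * (∑' n : ℕ, ((n + 1 : ℕ) : ℝ) ^ (-(5 / 4 : ℝ))) +
        3 * 2 ^ q.primeFactors.card) * ‖(2 : ℂ) + y * I‖) + 5 := by
  set c : ℂ := 2 + y * I with hc
  set Cq : ℝ := q * (∑' n : ℕ, ((n + 1 : ℕ) : ℝ) ^ (-(5 / 4 : ℝ))) + 3 * 2 ^ q.primeFactors.card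
    with hCq
  have hCq3 : 3 ≤ Cq := three_le_LConst
  have hcre : c.re = 2 := by simp [hc]
  have hcim : c.im = y := by simp [hc]
  have hlow : 1 / 2 ≤ ‖χ.LFunction c‖ := by
    have h := DirichletZFR.norm_LFunction_ge χ (s := c) (by rw [hcre]; norm_num)
    rw [hcre] at h; norm_num at h; exact h
  have hup : ‖χ.LFunction c‖ ≤ Cq * ‖c‖ :=
    norm_LFunction_le_uniform χ (by rw [hcre]; norm_num) (by rwa [hcim])
  have hc2 : 2 ≤ ‖c‖ := by
    have := abs_re_le_norm c; rw [hcre] at this; norm_num at this; exact this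
  have hprod : 1 ≤ Cq * ‖c‖ := by nlinarith
  have hlog : |Real.log ‖χ.LFunction c‖| ≤ Real.log (Cq * ‖c‖) + Real.log 2 := by
    have hpos : 0 < ‖χ.LFunction c‖ := by linarith
    rw [abs_le]
    constructor
    · have h1 : Real.log (1 / 2) ≤ Real.log ‖χ.LFunction c‖ := Real.log_le_log (by norm_num) hlow
      have h2 : Real.log (1 / 2) = -Real.log 2 := by
        rw [one_div, Real.log_inv]
      have h3 : 0 ≤ Real.log (Cq * ‖c‖) := Real.log_nonneg hprod
      linarith
    · have h1 : Real.log ‖χ.LFunction c‖ ≤ Real.log (Cq * ‖c‖) := Real.log_le_log hpos hup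
      have h2 : 0 ≤ Real.log 2 := Real.log_nonneg (by norm_num)
      linarith
  have hlog2 : Real.log 2 ≤ 1 := by
    have := Real.log_two_lt_d9; linarith
  have hpi : π ≤ 3.15 := Real.pi_lt_d2.le
  calc ‖log (χ.LFunction c)‖ ≤ |Real.log ‖χ.LFunction c‖| + π := norm_log_le_abs_log_add_pi _
    _ ≤ Real.log (Cq * ‖c‖) + Real.log 2 + π := by gcongr
    _ ≤ Real.log (Cq * ‖c‖) + 5 := by linarith

/-- **`L'/L` in the zero-free region.** Suppose every zero of every `L(·, χ)` (`χ mod q`) in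
the strip `0 < Re s < 1` has `Re s ≤ B` (`1/2 ≤ B`), and let `B < μ ≤ 1`, `κ = (μ − B)/2`. Then
for `μ ≤ σ ≤ 3` and `|y| ≥ 4`, `‖L'(σ+iy, χ)/L(σ+iy, χ)‖ ≤ 64 C_q κ^{-2} (4 + |y|)`:
`norm_logDeriv_le_of_ball` on the disc of centre `2 + iy`, radius `2 − B − κ` (inside the
zero-free region and away from `s = 1`), `r = 2 − μ`, with `‖L‖ ≤ C_q(4 + |y|)` on the disc and
`‖log L(2+iy, χ)‖ ≤ log(C_q(4+|y|)) + 5`. [folklore] -/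
theorem norm_logDeriv_LFunction_le {B μ : ℝ} (hB : 1 / 2 ≤ B) (hBμ : B < μ) (hμ1 : μ ≤ 1)
    (hzero : ∀ (χ : DirichletCharacter ℂ q) (s : ℂ), χ.LFunction s = 0 → 0 < s.re → s.re < 1 →
      s.re ≤ B)
    (χ : DirichletCharacter ℂ q) {σ : ℝ} (hσ : μ ≤ σ) (hσ3 : σ ≤ 3) {y : ℝ} (hy : 4 ≤ |y|) :
    ‖deriv χ.LFunction (σ + y * I) / χ.LFunction (σ + y * I)‖ ≤
      64 * (q * (∑' n : ℕ, ((n + 1 : ℕ) : ℝ) ^ (-(5 / 4 : ℝ))) + 3 * 2 ^ q.primeFactors.card) /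
        ((μ - B) / 2) ^ 2 * (4 + |y|) := by
  set Cq : ℝ := q * (∑' n : ℕ, ((n + 1 : ℕ) : ℝ) ^ (-(5 / 4 : ℝ))) + 3 * 2 ^ q.primeFactors.card
    with hCq
  have hCq3 : 3 ≤ Cq := three_le_LConst
  set κ : ℝ := (μ - B) / 2 with hκ
  have hκ0 : 0 < κ := by rw [hκ]; linarith
  set c : ℂ := 2 + y * I with hc
  set R : ℝ := 2 - B - κ with hR
  set r : ℝ := 2 - μ with hr
  have hr0 : 0 < r := by rw [hr]; linarith
  have hrR : r < R := by rw [hr, hR, hκ]; linarith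
  have hR2 : R < 2 := by rw [hR]; linarith
  have hRr : R - r = κ := by rw [hR, hr, hκ]; ring
  -- geometry of the disc
  have hball_re : ∀ w ∈ ball c R, B + κ ≤ w.re := by
    intro w hw
    rw [mem_ball, dist_eq_norm] at hw
    have := abs_re_le_norm (w - c)
    simp only [sub_re, hc, add_re, re_ofNat, mul_re, ofReal_re, I_re, mul_zero, ofReal_im, I_im,
      mul_one, sub_self, add_zero] at this
    rw [hR] at hw
    have := abs_le.mp (this.trans hw.le)
    linarith
  have hball_im : ∀ w ∈ ball c R, 1 ≤ |w.im| := by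
    intro w hw
    rw [mem_ball, dist_eq_norm] at hw
    have := abs_im_le_norm (w - c)
    simp only [sub_im, hc, add_im, im_ofNat, mul_im, ofReal_re, I_im, mul_one, ofReal_im, I_re,
      mul_zero, add_zero, zero_add] at this
    have h1 : |w.im - y| < 2 := by linarith
    have := abs_sub_abs_le_abs_sub y w.im
    rw [abs_sub_comm] at this
    linarith
  have hball_norm : ∀ w ∈ ball c R, ‖w‖ ≤ 4 + |y| := by
    intro w hw
    rw [mem_ball, dist_eq_norm] at hw
    have hcn : ‖c‖ ≤ 2 + |y| := by
      calc ‖c‖ ≤ ‖(2 : ℂ)‖ + ‖(y : ℂ) * I‖ := norm_add_le _ _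
        _ = 2 + |y| := by simp
    calc ‖w‖ = ‖(w - c) + c‖ := by ring_nf
      _ ≤ ‖w - c‖ + ‖c‖ := norm_add_le _ _
      _ ≤ 2 + (2 + |y|) := add_le_add (by linarith) hcn
      _ = 4 + |y| := by ring
  have hball_ne1 : ∀ w ∈ ball c R, w ≠ 1 := by
    intro w hw h
    have := hball_im w hw
    rw [h] at this; simp at this; linarith
  -- holomorphy, zero-freeness and size of `L(·, χ)` on the disc
  have hf : DifferentiableOn ℂ χ.LFunction (ball c R) := fun w hw ↦
    (DirichletCharacter.differentiableAt_LFunction χ w (.inl (hball_ne1 w hw))).differentiableWithinAt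
  have hf0 : ∀ w ∈ ball c R, χ.LFunction w ≠ 0 := by
    intro w hw h0
    have hwre := hball_re w hw
    rcases le_or_gt 1 w.re with h1 | h1
    · exact DirichletCharacter.LFunction_ne_zero_of_one_le_re χ (.inr (hball_ne1 w hw)) h1 h0
    · have := hzero χ w h0 (by linarith) h1
      linarith
  set M : ℝ := Real.log (Cq * (4 + |y|)) with hM
  have h4y : (4 : ℝ) ≤ 4 + |y| := by linarith [abs_nonneg y]
  have hCq4 : (3 : ℝ) * 4 ≤ Cq * (4 + |y|) := mul_le_mul hCq3 h4y (by norm_num) (by linarith)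
  have hM0 : 0 < M := Real.log_pos (by linarith)
  have hMle : M ≤ Cq * (4 + |y|) := (Real.log_le_sub_one_of_pos (by linarith)).trans (by linarith)
  have hfM : ∀ w ∈ ball c R, ‖χ.LFunction w‖ ≤ Real.exp M := by
    intro w hw
    rw [hM, Real.exp_log (by linarith)]
    calc ‖χ.LFunction w‖ ≤ Cq * ‖w‖ :=
          norm_LFunction_le_uniform χ (by linarith [hball_re w hw]) (hball_im w hw)
      _ ≤ Cq * (4 + |y|) := by gcongr; exact hball_norm w hw
  -- the point `σ + iy`
  have hz : ‖(σ + y * I : ℂ) - c‖ ≤ r := by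
    have h1 : (σ + y * I : ℂ) - c = ((σ - 2 : ℝ) : ℂ) := by rw [hc]; push_cast; ring
    rw [h1, Complex.norm_real, Real.norm_eq_abs, abs_le]
    rw [hr]
    constructor <;> linarith
  have key := norm_logDeriv_le_of_ball hr0 hrR hf hf0 hM0 hfM hz
  -- the value at the centre
  have hy1 : 1 ≤ |y| := by linarith
  have hlogc : ‖log (χ.LFunction c)‖ ≤ M + 5 := by
    have h := norm_log_LFunction_center_le χ hy1
    have hcn : ‖(2 : ℂ) + y * I‖ ≤ 4 + |y| := by
      calc ‖(2 : ℂ) + y * I‖ ≤ ‖(2 : ℂ)‖ + ‖(y : ℂ) * I‖ := norm_add_le _ _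
        _ = 2 + |y| := by simp
        _ ≤ 4 + |y| := by linarith
    have hmono : Real.log (Cq * ‖(2 : ℂ) + y * I‖) ≤ M := by
      rw [hM]
      refine Real.log_le_log ?_ (by gcongr)
      have : (2 : ℝ) ≤ ‖(2 : ℂ) + y * I‖ := by
        have := abs_re_le_norm ((2 : ℂ) + y * I); simp at this; exact this
      positivity
    linarith
  -- numerical simplification of the Borel–Carathéodory bound
  have hδ : (R - r) / 2 = κ / 2 := by rw [hRr]
  rw [hδ] at key
  have hRR' : R - (r + κ / 2) = κ / 2 := by rw [← hRr]; ring
  rw [hRR'] at key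
  have hR'2 : r + κ / 2 ≤ 2 := by linarith
  have hRpR' : R + (r + κ / 2) ≤ 4 := by linarith
  have hnum : 2 * M * (r + κ / 2) + ‖log (χ.LFunction c)‖ * (R + (r + κ / 2)) ≤
      16 * (Cq * (4 + |y|)) := by
    have h1 : 2 * M * (r + κ / 2) ≤ 2 * M * 2 := by gcongr
    have h2 : ‖log (χ.LFunction c)‖ * (R + (r + κ / 2)) ≤ (M + 5) * 4 :=
      mul_le_mul hlogc hRpR' (by linarith) (by linarith)
    have h3 : (4 : ℝ) ≤ Cq * (4 + |y|) := by linarith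
    linarith
  calc ‖deriv χ.LFunction (σ + y * I) / χ.LFunction (σ + y * I)‖
      ≤ (2 * M * (r + κ / 2) + ‖log (χ.LFunction c)‖ * (R + (r + κ / 2))) / (κ / 2 * (κ / 2)) :=
        key
    _ ≤ 16 * (Cq * (4 + |y|)) / (κ / 2 * (κ / 2)) :=
        div_le_div_of_nonneg_right hnum (by positivity)
    _ = 64 * Cq / κ ^ 2 * (4 + |y|) := by field_simp; ring

end LBounds

/-! ### The continued `L`-series of `Λ` on a residue class in the zero-free strip -/

section Aux

open ArithmeticFunction.vonMangoldt DirichletCharacter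

variable {q : ℕ} [NeZero q]

/-- In the region where no `L(·, χ)` vanishes (and at `s = 1`), Mathlib's
`LFunctionResidueClassAux a` (`= L(Λ_a, s) − φ⁻¹/(s−1)`, continued) is holomorphic. [folklore] -/
theorem differentiableAt_LFunctionResidueClassAux (a : ZMod q) {s : ℂ}
    (hs : s = 1 ∨ ∀ χ : DirichletCharacter ℂ q, χ.LFunction s ≠ 0) :
    DifferentiableAt ℂ (LFunctionResidueClassAux a) s := by
  classical
  have hZ1 : LFunctionTrivChar₁ q s ≠ 0 := by
    rcases eq_or_ne s 1 with rfl | hs1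
    · exact LFunctionTrivChar₁_apply_one_ne_zero q
    · rw [LFunctionTrivChar₁, Function.update_of_ne hs1]
      exact mul_ne_zero (sub_ne_zero.mpr hs1)
        ((hs.resolve_left hs1) 1)
  have hL : ∀ χ : DirichletCharacter ℂ q, χ ≠ 1 → χ.LFunction s ≠ 0 := by
    intro χ hχ
    rcases hs with rfl | hs
    · exact LFunction_ne_zero_of_one_le_re χ (.inl hχ) (by simp)
    · exact hs χ
  have hZd : Differentiable ℂ (LFunctionTrivChar₁ q) := differentiable_LFunctionTrivChar₁ q
  have hZd' : DifferentiableAt ℂ (deriv (LFunctionTrivChar₁ q)) s :=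
    ((hZd.differentiableOn.analyticOnNhd isOpen_univ).deriv s trivial).differentiableAt
  have hLd : ∀ χ : DirichletCharacter ℂ q, χ ≠ 1 → DifferentiableAt ℂ χ.LFunction s :=
    fun χ hχ ↦ differentiable_LFunction hχ s
  have hLd' : ∀ χ : DirichletCharacter ℂ q, χ ≠ 1 → DifferentiableAt ℂ (deriv χ.LFunction) s :=
    fun χ hχ ↦ (((differentiable_LFunction hχ).differentiableOn.analyticOnNhd isOpen_univ).deriv s
      trivial).differentiableAt
  rw [show LFunctionResidueClassAux a = fun s ↦ _ from rfl]
  simp only [LFunctionResidueClassAux]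
  refine (differentiableAt_const _).mul (DifferentiableAt.sub ?_ ?_)
  · exact (hZd'.neg.div (hZd s) hZ1)
  · refine DifferentiableAt.fun_sum fun χ hχ ↦ ?_
    replace hχ : χ ≠ 1 := by simpa only [ne_eq, Finset.mem_compl, Finset.mem_singleton] using hχ
    exact ((differentiableAt_const _).mul (hLd' χ hχ)).div (hLd χ hχ) (hL χ hχ)

open scoped Classical in
/-- In the zero-free region, for `s ≠ 1` with `L(s, χ) ≠ 0` for all `χ`:
`Aux_a(s) = φ⁻¹(−(L'/L(s,1) + 1/(s−1)) − ∑_{χ ≠ 1} χ(a⁻¹) L'/L(s, χ))`. [folklore] -/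
theorem LFunctionResidueClassAux_eq_of_ne_one (a : ZMod q) {s : ℂ} (hs1 : s ≠ 1)
    (hL1 : (1 : DirichletCharacter ℂ q).LFunction s ≠ 0) :
    LFunctionResidueClassAux a s = (q.totient : ℂ)⁻¹ *
      (-(deriv (1 : DirichletCharacter ℂ q).LFunction s / (1 : DirichletCharacter ℂ q).LFunction s +
        1 / (s - 1)) -
      ∑ χ ∈ ({1}ᶜ : Finset (DirichletCharacter ℂ q)),
        χ a⁻¹ * deriv (LFunction χ) s / LFunction χ s) := by
  rw [show LFunctionResidueClassAux a = fun s ↦ _ from rfl]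
  simp only [LFunctionResidueClassAux]
  have hs1' : s - 1 ≠ 0 := sub_ne_zero.mpr hs1
  congr 2
  · rw [deriv_LFunctionTrivChar₁_apply_of_ne_one q hs1, LFunctionTrivChar₁, Function.update_of_ne hs1,
      LFunctionTrivChar]
    field_simp
  · exact Finset.sum_congr (Finset.ext fun χ ↦ by simp) fun _ _ ↦ rfl

open scoped Classical in
/-- **Linear bound for `Aux_a` at height `|y| ≥ 4`** in the strip `μ ≤ Re s ≤ 3`, under the
zero-free hypothesis `Re ρ ≤ B` (`1/2 ≤ B < μ ≤ 1`):
`‖Aux_a(σ+iy)‖ ≤ (1 + (N_q + 1) · 64 C_q κ^{-2}) (4 + |y|)`, `N_q` the number of characters,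
`κ = (μ−B)/2`. [folklore] -/
theorem norm_LFunctionResidueClassAux_le_of_large {B μ : ℝ} (hB : 1 / 2 ≤ B) (hBμ : B < μ)
    (hμ1 : μ ≤ 1)
    (hzero : ∀ (χ : DirichletCharacter ℂ q) (s : ℂ), χ.LFunction s = 0 → 0 < s.re → s.re < 1 →
      s.re ≤ B)
    (a : ZMod q) {σ : ℝ} (hσ : μ ≤ σ) (hσ3 : σ ≤ 3) {y : ℝ} (hy : 4 ≤ |y|) :
    ‖LFunctionResidueClassAux a (σ + y * I)‖ ≤
      (1 + (Fintype.card (DirichletCharacter ℂ q) + 1) *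
        (64 * (q * (∑' n : ℕ, ((n + 1 : ℕ) : ℝ) ^ (-(5 / 4 : ℝ))) + 3 * 2 ^ q.primeFactors.card) /
          ((μ - B) / 2) ^ 2)) * (4 + |y|) := by
  set Kl : ℝ := 64 * (q * (∑' n : ℕ, ((n + 1 : ℕ) : ℝ) ^ (-(5 / 4 : ℝ))) +
    3 * 2 ^ q.primeFactors.card) / ((μ - B) / 2) ^ 2 with hKl
  have hKl0 : 0 ≤ Kl := by
    have := three_le_LConst (q := q)
    rw [hKl]; positivity
  set s : ℂ := σ + y * I with hsdef
  have hsre : s.re = σ := by simp [hsdef]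
  have hsim : s.im = y := by simp [hsdef]
  have hs1 : s ≠ 1 := by
    intro h; rw [h] at hsim; simp at hsim; rw [← hsim] at hy; simp at hy; linarith
  have hLne : ∀ χ : DirichletCharacter ℂ q, χ.LFunction s ≠ 0 := by
    intro χ h0
    rcases le_or_gt 1 s.re with h1 | h1
    · exact LFunction_ne_zero_of_one_le_re χ (.inr hs1) h1 h0
    · have := hzero χ s h0 (by rw [hsre]; linarith) h1
      rw [hsre] at this; linarith
  have hbd : ∀ χ : DirichletCharacter ℂ q,
      ‖deriv χ.LFunction s / χ.LFunction s‖ ≤ Kl * (4 + |y|) :=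
    fun χ ↦ norm_logDeriv_LFunction_le hB hBμ hμ1 hzero χ hσ hσ3 hy
  have h4y : (1 : ℝ) ≤ 4 + |y| := by linarith [abs_nonneg y]
  -- the principal term
  have hinv : ‖1 / (s - 1)‖ ≤ 1 := by
    rw [norm_div, norm_one, div_le_one (norm_pos_iff.mpr (sub_ne_zero.mpr hs1))]
    have := abs_im_le_norm (s - 1)
    simp only [sub_im, one_im, sub_zero, hsim] at this
    linarith
  have hφ : ‖((q.totient : ℂ))⁻¹‖ ≤ 1 := by
    rw [norm_inv, Complex.norm_natCast]
    exact inv_le_one_of_one_le₀ (by exact_mod_cast Nat.totient_pos.mpr (NeZero.pos q))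
  rw [LFunctionResidueClassAux_eq_of_ne_one a hs1 (hLne 1)]
  have hsum : ‖∑ χ ∈ ({1}ᶜ : Finset (DirichletCharacter ℂ q)),
      χ a⁻¹ * deriv (LFunction χ) s / LFunction χ s‖ ≤
      Fintype.card (DirichletCharacter ℂ q) * (Kl * (4 + |y|)) := by
    calc ‖∑ χ ∈ ({1}ᶜ : Finset (DirichletCharacter ℂ q)),
          χ a⁻¹ * deriv (LFunction χ) s / LFunction χ s‖
        ≤ ∑ χ ∈ ({1}ᶜ : Finset (DirichletCharacter ℂ q)),
          ‖χ a⁻¹ * deriv (LFunction χ) s / LFunction χ s‖ := norm_sum_le _ _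
      _ ≤ ∑ χ ∈ ({1}ᶜ : Finset (DirichletCharacter ℂ q)), Kl * (4 + |y|) := by
          refine Finset.sum_le_sum fun χ _ ↦ ?_
          rw [mul_div_assoc, norm_mul]
          calc ‖χ a⁻¹‖ * ‖deriv (LFunction χ) s / LFunction χ s‖ ≤ 1 * (Kl * (4 + |y|)) :=
                mul_le_mul (DirichletCharacter.norm_le_one χ _) (hbd χ) (norm_nonneg _) zero_le_one
            _ = Kl * (4 + |y|) := one_mul _
      _ ≤ ∑ _χ : DirichletCharacter ℂ q, Kl * (4 + |y|) :=
          Finset.sum_le_univ_sum_of_nonneg fun _ ↦ by positivity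
      _ = Fintype.card (DirichletCharacter ℂ q) * (Kl * (4 + |y|)) := by
          rw [Finset.sum_const, nsmul_eq_mul, Finset.card_univ]
  have hmain : ‖-(deriv (1 : DirichletCharacter ℂ q).LFunction s /
        (1 : DirichletCharacter ℂ q).LFunction s + 1 / (s - 1)) -
      ∑ χ ∈ ({1}ᶜ : Finset (DirichletCharacter ℂ q)),
        χ a⁻¹ * deriv (LFunction χ) s / LFunction χ s‖ ≤
      1 + (Fintype.card (DirichletCharacter ℂ q) + 1) * (Kl * (4 + |y|)) := by
    calc _ ≤ ‖-(deriv (1 : DirichletCharacter ℂ q).LFunction s /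
          (1 : DirichletCharacter ℂ q).LFunction s + 1 / (s - 1))‖ +
          ‖∑ χ ∈ ({1}ᶜ : Finset (DirichletCharacter ℂ q)),
            χ a⁻¹ * deriv (LFunction χ) s / LFunction χ s‖ := norm_sub_le _ _
      _ ≤ (Kl * (4 + |y|) + 1) + Fintype.card (DirichletCharacter ℂ q) * (Kl * (4 + |y|)) := by
          refine add_le_add ?_ hsum
          rw [norm_neg]
          exact (norm_add_le _ _).trans (add_le_add (hbd 1) hinv)
      _ = 1 + (Fintype.card (DirichletCharacter ℂ q) + 1) * (Kl * (4 + |y|)) := by ring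
  calc _ ≤ ‖((q.totient : ℂ))⁻¹‖ * ‖-(deriv (1 : DirichletCharacter ℂ q).LFunction s /
        (1 : DirichletCharacter ℂ q).LFunction s + 1 / (s - 1)) -
      ∑ χ ∈ ({1}ᶜ : Finset (DirichletCharacter ℂ q)),
        χ a⁻¹ * deriv (LFunction χ) s / LFunction χ s‖ := norm_mul_le _ _
    _ ≤ 1 * (1 + (Fintype.card (DirichletCharacter ℂ q) + 1) * (Kl * (4 + |y|))) :=
        mul_le_mul hφ hmain (norm_nonneg _) zero_le_one
    _ ≤ (1 + (Fintype.card (DirichletCharacter ℂ q) + 1) * Kl) * (4 + |y|) := by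
        rw [one_mul]
        have : 0 ≤ (Fintype.card (DirichletCharacter ℂ q) + 1 : ℝ) * Kl := by positivity
        nlinarith

/-- **Linear bound for `Aux_a` on the whole strip `μ ≤ Re s ≤ 3`** under the zero-free
hypothesis: `‖Aux_a(σ + iy)‖ ≤ K (4 + |y|)` (compactness for `|y| ≤ 4`, the previous lemma
for `|y| ≥ 4`). [folklore] -/
theorem exists_norm_LFunctionResidueClassAux_le {B μ : ℝ} (hB : 1 / 2 ≤ B) (hBμ : B < μ)
    (hμ1 : μ ≤ 1)
    (hzero : ∀ (χ : DirichletCharacter ℂ q) (s : ℂ), χ.LFunction s = 0 → 0 < s.re → s.re < 1 →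
      s.re ≤ B)
    (a : ZMod q) :
    ∃ K : ℝ, 0 ≤ K ∧ ∀ σ : ℝ, μ ≤ σ → σ ≤ 3 → ∀ y : ℝ,
      ‖LFunctionResidueClassAux a (σ + y * I)‖ ≤ K * (4 + |y|) := by
  -- compactness on `[μ, 3] × [-4, 4]`
  set S : Set ℂ := (Icc μ 3) ×ℂ (Icc (-4 : ℝ) 4) with hS
  have hSc : IsCompact S := isCompact_Icc.reProdIm isCompact_Icc
  have hsub : S ⊆ {s : ℂ | s = 1 ∨ ∀ χ : DirichletCharacter ℂ q, χ.LFunction s ≠ 0} := by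
    intro s hs
    rw [hS, mem_reProdIm] at hs
    rcases eq_or_ne s 1 with rfl | hs1
    · exact Or.inl rfl
    · refine Or.inr fun χ h0 ↦ ?_
      rcases le_or_gt 1 s.re with h1 | h1
      · exact LFunction_ne_zero_of_one_le_re χ (.inr hs1) h1 h0
      · have := hzero χ s h0 (by linarith [hs.1.1]) h1
        linarith [hs.1.1]
  have hcont : ContinuousOn (LFunctionResidueClassAux a) S :=
    (continuousOn_LFunctionResidueClassAux' a).mono hsub
  obtain ⟨K₀, hK₀⟩ := hSc.exists_bound_of_continuousOn hcont
  set K₁ : ℝ := 1 + (Fintype.card (DirichletCharacter ℂ q) + 1) *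
    (64 * (q * (∑' n : ℕ, ((n + 1 : ℕ) : ℝ) ^ (-(5 / 4 : ℝ))) + 3 * 2 ^ q.primeFactors.card) /
      ((μ - B) / 2) ^ 2) with hK₁
  refine ⟨max (max K₀ 0) K₁, le_max_of_le_left (le_max_right _ _), fun σ hσ hσ3 y ↦ ?_⟩
  have h4y : (1 : ℝ) ≤ 4 + |y| := by linarith [abs_nonneg y]
  rcases le_or_gt |y| 4 with hy | hy
  · have hmem : (σ + y * I : ℂ) ∈ S := by
      rw [hS, mem_reProdIm]
      simp only [add_re, ofReal_re, mul_re, I_re, mul_zero, ofReal_im, I_im, mul_one, sub_self,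
        add_zero, mem_Icc, add_im, mul_im, zero_add]
      exact ⟨⟨hσ, hσ3⟩, abs_le.mp hy⟩
    calc ‖LFunctionResidueClassAux a (σ + y * I)‖ ≤ K₀ := hK₀ _ hmem
      _ ≤ max (max K₀ 0) K₁ * 1 := by
          rw [mul_one]; exact le_max_of_le_left (le_max_left _ _)
      _ ≤ max (max K₀ 0) K₁ * (4 + |y|) := by gcongr
  · calc ‖LFunctionResidueClassAux a (σ + y * I)‖ ≤ K₁ * (4 + |y|) :=
          norm_LFunctionResidueClassAux_le_of_large hB hBμ hμ1 hzero a hσ hσ3 hy.le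
      _ ≤ max (max K₀ 0) K₁ * (4 + |y|) := by gcongr; exact le_max_right _ _

end Aux

/-! ### An unconditional bound `E_a(t) = O(1/t)` (Chebyshev) -/

section Chebyshev

open ArithmeticFunction.vonMangoldt Finset
open scoped Chebyshev

variable {q : ℕ} [NeZero q]

omit [NeZero q] in
/-- Summation by parts for a Laplace series: `∑ uₙ e^{-nt} = (1 − e^{-t}) ∑ₙ (∑_{m ≤ n} uₘ) e^{-nt}`
(`t > 0`, `|uₙ| ≤ n + 1`). [folklore] -/
theorem laplaceSeries_eq_mul_tsum_partialSum {u : ℕ → ℝ} (hu : ∀ n, |u n| ≤ (n : ℝ) + 1)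
    {t : ℝ} (ht : 0 < t) :
    Summable (fun n : ℕ ↦ (∑ m ∈ range (n + 1), u m) * Real.exp (-t * n)) ∧
      laplaceSeries u t =
        (1 - Real.exp (-t)) * ∑' n : ℕ, (∑ m ∈ range (n + 1), u m) * Real.exp (-t * n) := by
  have hr0 : 0 ≤ Real.exp (-t) := (Real.exp_pos _).le
  have hr1 : Real.exp (-t) < 1 := Real.exp_lt_one_iff.mpr (by linarith)
  have hu' : ∀ n, |u n| ≤ 1 * ((n : ℝ) + 1) ^ 1 := fun n ↦ by rw [one_mul, pow_one]; exact hu n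
  have hu_s := summable_abs_mul_exp_of_le hu' ht
  have hA : ∀ n : ℕ, |∑ m ∈ range (n + 1), u m| ≤ 1 * ((n : ℝ) + 1) ^ 2 := by
    intro n
    calc |∑ m ∈ range (n + 1), u m| ≤ ∑ m ∈ range (n + 1), |u m| := abs_sum_le_sum_abs _ _
      _ ≤ ∑ _m ∈ range (n + 1), ((n : ℝ) + 1) := by
          refine sum_le_sum fun m hm ↦ (hu m).trans ?_
          have : (m : ℝ) ≤ n := by exact_mod_cast Nat.lt_succ_iff.mp (mem_range.mp hm)
          linarith
      _ = 1 * ((n : ℝ) + 1) ^ 2 := by rw [sum_const, card_range, nsmul_eq_mul]; push_cast; ring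
  have hA_s : Summable fun n : ℕ ↦ ‖(∑ m ∈ range (n + 1), u m) * Real.exp (-t * n)‖ :=
    summable_abs_mul_exp_of_le (B := 1) (k := 2) hA ht
  have hgeom_s : Summable fun n : ℕ ↦ ‖(1 : ℝ) * Real.exp (-t * n)‖ := by
    refine summable_abs_mul_exp_of_le (B := 1) (k := 0) (fun n ↦ ?_) ht
    simp
  refine ⟨hA_s.of_norm, ?_⟩
  have hgeom : ∑' n : ℕ, (1 : ℝ) * Real.exp (-t * n) = (1 - Real.exp (-t))⁻¹ := by
    simp_rw [one_mul, exp_neg_mul_natCast]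
    exact tsum_geometric_of_lt_one hr0 hr1
  have hparts : laplaceSeries u t * (1 - Real.exp (-t))⁻¹ =
      ∑' n : ℕ, (∑ m ∈ range (n + 1), u m) * Real.exp (-t * n) := by
    rw [laplaceSeries_def, ← hgeom, tsum_mul_exp_mul_tsum_mul_exp hu_s hgeom_s]
    refine tsum_congr fun n ↦ ?_
    congr 1
    rw [Nat.sum_antidiagonal_eq_sum_range_succ (fun i _ ↦ u i * 1) n]
    simp
  have hq : (1 - Real.exp (-t)) ≠ 0 := by linarith
  rw [← hparts]
  field_simp

omit [NeZero q] in
/-- **Chebyshev on the Laplace side:** `∑ Λ(n) e^{-nt} ≤ (log 4 + 4) K(1) t^{-1}` for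
`0 < t ≤ 1` (Mathlib's `Chebyshev.psi_le_const_mul_self`, summed by parts). [folklore] -/
theorem laplaceSeries_vonMangoldt_le {t : ℝ} (ht : 0 < t) (ht1 : t ≤ 1) :
    laplaceSeries (fun n ↦ Λ n) t ≤ (Real.log 4 + 4) * geomWeightConst 1 * t ^ (-(1 : ℝ)) := by
  have hΛ : ∀ n, |Λ n| ≤ (n : ℝ) + 1 := fun n ↦ by
    rw [abs_of_nonneg ArithmeticFunction.vonMangoldt_nonneg]; exact (vonMangoldt_nonneg_le n).2
  obtain ⟨hS, hid⟩ := laplaceSeries_eq_mul_tsum_partialSum hΛ ht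
  obtain ⟨hq1, hq2, -⟩ := one_sub_exp_neg_bounds ht ht1
  obtain ⟨hWs, hW⟩ := tsum_pow_succ_rpow_mul_exp_le zero_le_one ht ht1
  have hc : 0 ≤ Real.log 4 + 4 := by positivity
  -- `∑_{m ≤ n} Λ(m) = ψ(n) ≤ c n ≤ c (n+1)`
  have hpsi : ∀ n : ℕ, ∑ m ∈ Finset.range (n + 1), Λ m ≤
      (Real.log 4 + 4) * ((n : ℝ) + 1) ^ (1 : ℝ) := by
    intro n
    have h1 : ∑ m ∈ Finset.range (n + 1), Λ m = ψ (n : ℝ) := by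
      rw [Chebyshev.psi_eq_sum_Icc, Nat.floor_natCast]
      refine Finset.sum_congr ?_ fun _ _ ↦ rfl
      ext m
      simp
    rw [h1, Real.rpow_one]
    calc ψ (n : ℝ) ≤ (Real.log 4 + 4) * n := Chebyshev.psi_le_const_mul_self n.cast_nonneg
      _ ≤ (Real.log 4 + 4) * ((n : ℝ) + 1) := by gcongr; linarith
  have hsum_le : ∑' n : ℕ, (∑ m ∈ Finset.range (n + 1), Λ m) * Real.exp (-t * n) ≤
      (Real.log 4 + 4) * (geomWeightConst 1 * t ^ (-(1 + 1 : ℝ))) := by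
    calc ∑' n : ℕ, (∑ m ∈ Finset.range (n + 1), Λ m) * Real.exp (-t * n)
        ≤ ∑' n : ℕ, (Real.log 4 + 4) * (((n : ℝ) + 1) ^ (1 : ℝ) * Real.exp (-t * n)) := by
          refine hS.tsum_le_tsum (fun n ↦ ?_) (hWs.mul_left _)
          rw [← mul_assoc]
          exact mul_le_mul_of_nonneg_right (hpsi n) (Real.exp_pos _).le
      _ = (Real.log 4 + 4) * ∑' n : ℕ, ((n : ℝ) + 1) ^ (1 : ℝ) * Real.exp (-t * n) :=
          tsum_mul_left
      _ ≤ (Real.log 4 + 4) * (geomWeightConst 1 * t ^ (-(1 + 1 : ℝ))) := by gcongr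
  rw [hid]
  have hK := geomWeightConst_nonneg 1
  calc (1 - Real.exp (-t)) * ∑' n : ℕ, (∑ m ∈ Finset.range (n + 1), Λ m) * Real.exp (-t * n)
      ≤ t * ((Real.log 4 + 4) * (geomWeightConst 1 * t ^ (-(1 + 1 : ℝ)))) :=
        mul_le_mul hq2 hsum_le (tsum_nonneg fun n ↦ mul_nonneg
          (Finset.sum_nonneg fun m _ ↦ ArithmeticFunction.vonMangoldt_nonneg) (Real.exp_pos _).le) ht.le
    _ = (Real.log 4 + 4) * geomWeightConst 1 * t ^ (-(1 : ℝ)) := by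
        rw [show (-(1 + 1 : ℝ)) = -(1 : ℝ) + -(1 : ℝ) by norm_num, Real.rpow_add ht,
          Real.rpow_neg_one]
        field_simp

/-- **Unconditionally `|E_a(t)| ≤ ((log 4 + 4)K(1) + 1) t^{-1}` on `(0, 1]`**
(`0 ≤ F_a ≤ ∑ Λ(n)e^{-nt}`). [folklore] -/
theorem abs_errLaplace_le_inv (a : ZMod q) {t : ℝ} (ht : 0 < t) (ht1 : t ≤ 1) :
    |laplaceSeries (residueClass a) t - Real.exp (-t) / ((q.totient : ℝ) * t)| ≤
      ((Real.log 4 + 4) * geomWeightConst 1 + 1) * t ^ (-(1 : ℝ)) := by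
  have hφ : (1 : ℝ) ≤ q.totient := by exact_mod_cast Nat.totient_pos.mpr (NeZero.pos q)
  have hΛ' : ∀ n, |Λ n| ≤ 1 * ((n : ℝ) + 1) ^ 1 := fun n ↦ by
    rw [abs_of_nonneg ArithmeticFunction.vonMangoldt_nonneg, one_mul, pow_one]; exact (vonMangoldt_nonneg_le n).2
  have h0 : 0 ≤ laplaceSeries (residueClass a) t := laplaceSeries_nonneg (residueClass_nonneg a) t
  have hle : laplaceSeries (residueClass a) t ≤ laplaceSeries (fun n ↦ Λ n) t := by
    rw [laplaceSeries_def, laplaceSeries_def]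
    exact Summable.tsum_le_tsum (fun n ↦ mul_le_mul_of_nonneg_right (residueClass_le a n)
      (Real.exp_pos _).le) (summable_abs_mul_exp_of_le (abs_residueClass_le' a) ht).of_norm
      (summable_abs_mul_exp_of_le hΛ' ht).of_norm
  have hF := laplaceSeries_vonMangoldt_le ht ht1
  have htinv : t ^ (-(1 : ℝ)) = t⁻¹ := Real.rpow_neg_one t
  have h2 : |Real.exp (-t) / ((q.totient : ℝ) * t)| ≤ t ^ (-(1 : ℝ)) := by
    rw [abs_of_nonneg (by positivity), htinv, div_le_iff₀ (by positivity)]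
    have he : Real.exp (-t) ≤ 1 := Real.exp_le_one_iff.mpr (by linarith)
    calc Real.exp (-t) ≤ 1 := he
      _ = t⁻¹ * (1 * t) := by field_simp
      _ ≤ t⁻¹ * ((q.totient : ℝ) * t) := by gcongr
  calc |laplaceSeries (residueClass a) t - Real.exp (-t) / ((q.totient : ℝ) * t)|
      ≤ |laplaceSeries (residueClass a) t| + |Real.exp (-t) / ((q.totient : ℝ) * t)| :=
        abs_sub _ _
    _ ≤ (Real.log 4 + 4) * geomWeightConst 1 * t ^ (-(1 : ℝ)) + t ^ (-(1 : ℝ)) := by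
        rw [abs_of_nonneg h0]; exact add_le_add (hle.trans hF) h2
    _ = ((Real.log 4 + 4) * geomWeightConst 1 + 1) * t ^ (-(1 : ℝ)) := by ring

end Chebyshev

/-! ### Mellin inversion and the shift of contour -/

section Inversion

open ArithmeticFunction.vonMangoldt DirichletCharacter

variable {q : ℕ} [NeZero q]

/-- **The a-priori bound from a strip bound** (the analytic core). Let `1/2 ≤ B < μ ≤ 1`, all
`L(·, χ)` mod `q` zero-free on `B < Re s < 1`, and `‖Aux_a(σ+iy)‖ ≤ K(4 + |y|)` for
`μ ≤ σ ≤ 3`. Then `|E_a(t)| ≤ 1200 K t^{-μ}` for `0 < t ≤ 1`: Mellin inversion on `Re s = 3`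
(Mathlib `mellinInv_mellin_eq`; `∫₀^∞ E_a(t)t^{s-1}dt = Γ(s)Aux_a(s)`), Cauchy's theorem on
the rectangles `[μ, 3] × [−T, T]` with `T → ∞`
(`Literature.NumberTheory.LFunctions.MertensBoundRH.integral_vertical_eq_of_tendsto`; the
integrand `t^{-s}Γ(s)Aux_a(s)` is holomorphic on `Re s > B` and `≪ t^{-3}(1+|Im s|²)^{-1}`
there by `|Γ(s)| ≤ 120/|Im s|³`), and the trivial estimate on `Re s = μ`. [folklore] -/
theorem abs_errLaplace_le_of_strip_bound {a : ZMod q} (ha : IsUnit a) {B μ K : ℝ}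
    (hB : 1 / 2 ≤ B) (hBμ : B < μ) (hμ1 : μ ≤ 1) (hK : 0 ≤ K)
    (hzero : ∀ (χ : DirichletCharacter ℂ q) (s : ℂ), χ.LFunction s = 0 → 0 < s.re → s.re < 1 →
      s.re ≤ B)
    (hAux : ∀ σ : ℝ, μ ≤ σ → σ ≤ 3 → ∀ y : ℝ,
      ‖LFunctionResidueClassAux a (σ + y * I)‖ ≤ K * (4 + |y|))
    {t : ℝ} (ht : 0 < t) (ht1 : t ≤ 1) :
    |laplaceSeries (residueClass a) t - Real.exp (-t) / ((q.totient : ℝ) * t)| ≤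
      1200 * K * t ^ (-μ) := by
  have hμ3 : μ ≤ 3 := by linarith
  have hμ0 : 0 < μ := by linarith
  set f : ℝ → ℂ := fun t ↦ ((laplaceSeries (residueClass a) t -
    Real.exp (-t) / ((q.totient : ℝ) * t) : ℝ) : ℂ) with hf
  set F : ℂ → ℂ := fun s ↦ (t : ℂ) ^ (-s) * (Complex.Gamma s * LFunctionResidueClassAux a s)
    with hF
  have ht0 : (t : ℂ) ≠ 0 := ofReal_ne_zero.mpr ht.ne'
  -- regularity in the closed strip `Re s ≥ μ`
  have hreg : ∀ s : ℂ, μ ≤ s.re → (s = 1 ∨ ∀ χ : DirichletCharacter ℂ q, χ.LFunction s ≠ 0) := by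
    intro s hs
    rcases eq_or_ne s 1 with rfl | hs1
    · exact Or.inl rfl
    · refine Or.inr fun χ h0 ↦ ?_
      rcases le_or_gt 1 s.re with h1 | h1
      · exact LFunction_ne_zero_of_one_le_re χ (.inr hs1) h1 h0
      · have := hzero χ s h0 (by linarith) h1
        linarith
  have hΓd : ∀ s : ℂ, μ ≤ s.re → DifferentiableAt ℂ Complex.Gamma s := by
    intro s hs
    refine Complex.differentiableAt_Gamma s fun m hm ↦ ?_
    have : μ ≤ (-(m : ℂ)).re := hm ▸ hs
    simp at this
    linarith [(m.cast_nonneg : (0 : ℝ) ≤ m)]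
  have hGAd : ∀ s : ℂ, μ ≤ s.re →
      DifferentiableAt ℂ (fun s ↦ Complex.Gamma s * LFunctionResidueClassAux a s) s :=
    fun s hs ↦ (hΓd s hs).mul (differentiableAt_LFunctionResidueClassAux a (hreg s hs))
  have hFdiff : ∀ s : ℂ, μ ≤ s.re → DifferentiableAt ℂ F s := by
    intro s hs
    have h1 : DifferentiableAt ℂ (fun s : ℂ ↦ (t : ℂ) ^ (-s)) s :=
      differentiableAt_id.neg.const_cpow (Or.inl ht0)
    exact h1.mul (hGAd s hs)
  -- the pointwise bound in the strip
  have hGA : ∀ σ : ℝ, μ ≤ σ → σ ≤ 3 → ∀ y : ℝ,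
      ‖Complex.Gamma (σ + y * I) * LFunctionResidueClassAux a (σ + y * I)‖ ≤
        2400 * K * (1 + y ^ 2)⁻¹ := by
    intro σ hσ hσ3 y
    rw [norm_mul]
    calc ‖Complex.Gamma (σ + y * I)‖ * ‖LFunctionResidueClassAux a (σ + y * I)‖
        ≤ ‖Complex.Gamma (σ + y * I)‖ * (K * (4 + |y|)) :=
          mul_le_mul_of_nonneg_left (hAux σ hσ hσ3 y) (norm_nonneg _)
      _ = K * (‖Complex.Gamma (σ + y * I)‖ * (4 + |y|)) := by ring
      _ ≤ K * (2400 * (1 + y ^ 2)⁻¹) :=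
          mul_le_mul_of_nonneg_left (norm_Gamma_mul_le (by linarith) hσ3 y) hK
      _ = 2400 * K * (1 + y ^ 2)⁻¹ := by ring
  have hFbound : ∀ σ : ℝ, μ ≤ σ → σ ≤ 3 → ∀ y : ℝ,
      ‖F (σ + y * I)‖ ≤ t ^ (-σ) * (2400 * K * (1 + y ^ 2)⁻¹) := by
    intro σ hσ hσ3 y
    have hn1 : ‖(t : ℂ) ^ (-(σ + y * I : ℂ))‖ = t ^ (-σ) := by
      rw [Complex.norm_cpow_eq_rpow_re_of_pos ht]; congr 1; simp
    have hFσ : F (σ + y * I) = (t : ℂ) ^ (-(σ + y * I : ℂ)) *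
        (Complex.Gamma (σ + y * I) * LFunctionResidueClassAux a (σ + y * I)) := rfl
    rw [hFσ, norm_mul, hn1]
    exact mul_le_mul_of_nonneg_left (hGA σ hσ hσ3 y) (by positivity)
  -- continuity along vertical lines
  have hline : ∀ σ : ℝ, Continuous fun y : ℝ ↦ (σ : ℂ) + y * I := fun σ ↦ by fun_prop
  have hFcont : ∀ σ : ℝ, μ ≤ σ → Continuous fun y : ℝ ↦ F (σ + y * I) := by
    intro σ hσ
    refine continuous_iff_continuousAt.mpr fun y ↦ ?_
    have hs : μ ≤ ((σ : ℂ) + y * I).re := by simp; exact hσ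
    exact ContinuousAt.comp (f := fun y : ℝ ↦ (σ : ℂ) + y * I) (g := F)
      (hFdiff _ hs).continuousAt (hline σ).continuousAt
  -- integrability along the lines `Re s = σ`, `μ ≤ σ ≤ 3`
  have hFint : ∀ σ : ℝ, μ ≤ σ → σ ≤ 3 → Integrable fun y : ℝ ↦ F (σ + y * I) := by
    intro σ hσ hσ3
    refine Integrable.mono' (integrable_inv_one_add_sq.const_mul (t ^ (-σ) * (2400 * K)))
      (hFcont σ hσ).aestronglyMeasurable (ae_of_all _ fun y ↦ ?_)
    calc ‖F (σ + y * I)‖ ≤ t ^ (-σ) * (2400 * K * (1 + y ^ 2)⁻¹) := hFbound σ hσ hσ3 y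
      _ = t ^ (-σ) * (2400 * K) * (1 + y ^ 2)⁻¹ := by ring
  -- uniform decay on the horizontal segments
  have hdecay : ∀ ε : ℝ, 0 < ε → ∃ T₀ : ℝ, ∀ σ ∈ Icc μ 3, ∀ T : ℝ, T₀ ≤ |T| →
      ‖F (σ + T * I)‖ ≤ ε := by
    intro ε hε
    set M : ℝ := t ^ (-(3 : ℝ)) * (2400 * K) with hM
    have hM0 : 0 ≤ M := by positivity
    refine ⟨M / ε + 1, fun σ hσ T hT ↦ ?_⟩
    have htσ : t ^ (-σ) ≤ t ^ (-(3 : ℝ)) :=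
      Real.rpow_le_rpow_of_exponent_ge ht ht1 (by linarith [hσ.2])
    have h1 : ‖F (σ + T * I)‖ ≤ M * (1 + T ^ 2)⁻¹ := by
      calc ‖F (σ + T * I)‖ ≤ t ^ (-σ) * (2400 * K * (1 + T ^ 2)⁻¹) := hFbound σ hσ.1 hσ.2 T
        _ = t ^ (-σ) * (2400 * K) * (1 + T ^ 2)⁻¹ := by ring
        _ ≤ t ^ (-(3 : ℝ)) * (2400 * K) * (1 + T ^ 2)⁻¹ := by gcongr
    have hT2 : M / ε < 1 + T ^ 2 := by nlinarith [sq_abs T, abs_nonneg T, sq_nonneg (|T| - 1)]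
    have hMε : M < (1 + T ^ 2) * ε := (div_lt_iff₀ hε).mp hT2
    calc ‖F (σ + T * I)‖ ≤ M * (1 + T ^ 2)⁻¹ := h1
      _ ≤ ε := by
          rw [← div_eq_mul_inv, div_le_iff₀ (by positivity)]
          linarith
  -- Mellin inversion on `Re s = 3`
  have hconv : MellinConvergent f 3 := mellinConvergent_errLaplace a (by norm_num)
  have hmellin : ∀ y : ℝ, mellin f ((3 : ℝ) + y * I) =
      Complex.Gamma ((3 : ℝ) + y * I) * LFunctionResidueClassAux a ((3 : ℝ) + y * I) :=
    fun y ↦ mellin_errLaplace ha (by norm_num)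
  have hVI : VerticalIntegrable (mellin f) 3 := by
    have heq : (fun y : ℝ ↦ mellin f ((3 : ℝ) + y * I)) = fun y : ℝ ↦
        Complex.Gamma ((3 : ℝ) + y * I) * LFunctionResidueClassAux a ((3 : ℝ) + y * I) :=
      funext hmellin
    show Integrable (fun y : ℝ ↦ mellin f ((3 : ℝ) + y * I))
    rw [heq]
    have hcont3 : Continuous fun y : ℝ ↦
        Complex.Gamma ((3 : ℝ) + y * I) * LFunctionResidueClassAux a ((3 : ℝ) + y * I) := by
      refine continuous_iff_continuousAt.mpr fun y ↦ ?_
      have hs : μ ≤ (((3 : ℝ) : ℂ) + y * I).re := by simp; linarith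
      exact ContinuousAt.comp (f := fun y : ℝ ↦ ((3 : ℝ) : ℂ) + y * I)
        (g := fun s ↦ Complex.Gamma s * LFunctionResidueClassAux a s)
        (hGAd _ hs).continuousAt (hline 3).continuousAt
    refine Integrable.mono' (integrable_inv_one_add_sq.const_mul (2400 * K))
      hcont3.aestronglyMeasurable (ae_of_all _ fun y ↦ ?_)
    exact hGA 3 hμ3 le_rfl y
  have hcontf : ContinuousAt f t :=
    (Complex.continuous_ofReal.comp_continuousOn (continuousOn_errLaplace a)).continuousAt
      (Ioi_mem_nhds ht)
  have hinv := mellinInv_mellin_eq 3 f ht hconv hVI hcontf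
  have hinvF : mellinInv 3 (mellin f) t = (1 / (2 * π)) • ∫ y : ℝ, F ((3 : ℝ) + y * I) := by
    rw [mellinInv]
    congr 1
    refine integral_congr_ae (ae_of_all _ fun y ↦ ?_)
    simp only [hF, hmellin y, smul_eq_mul]
  -- the shift of contour
  have hFd : DifferentiableOn ℂ F (Icc μ 3 ×ℂ univ) := fun s hs ↦
    (hFdiff s (by rw [mem_reProdIm] at hs; exact hs.1.1)).differentiableWithinAt
  have hshift := MertensBoundRH.integral_vertical_eq_of_tendsto F hμ3 hFd (hFint μ le_rfl hμ3)
    (hFint 3 hμ3 le_rfl) hdecay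
  -- the estimate on `Re s = μ`
  have hint_le : ‖∫ y : ℝ, F (μ + y * I)‖ ≤ t ^ (-μ) * (2400 * K) * π := by
    have h := norm_integral_le_of_norm_le (integrable_inv_one_add_sq.const_mul (t ^ (-μ) * (2400 * K)))
      (ae_of_all _ fun y ↦ (show ‖F (μ + y * I)‖ ≤ t ^ (-μ) * (2400 * K) * (1 + y ^ 2)⁻¹ from by
        calc ‖F (μ + y * I)‖ ≤ t ^ (-μ) * (2400 * K * (1 + y ^ 2)⁻¹) := hFbound μ le_rfl hμ3 y
          _ = t ^ (-μ) * (2400 * K) * (1 + y ^ 2)⁻¹ := by ring))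
    rwa [integral_const_mul, integral_univ_inv_one_add_sq] at h
  have hnorm : ‖f t‖ ≤ 1200 * K * t ^ (-μ) := by
    rw [← hinv, hinvF, ← hshift, norm_smul, Real.norm_eq_abs, abs_of_pos (by positivity)]
    calc 1 / (2 * π) * ‖∫ y : ℝ, F (μ + y * I)‖ ≤ 1 / (2 * π) * (t ^ (-μ) * (2400 * K) * π) := by
          gcongr
      _ = 1200 * K * t ^ (-μ) := by field_simp; ring
  have hft : ‖f t‖ = |laplaceSeries (residueClass a) t - Real.exp (-t) / ((q.totient : ℝ) * t)| := by
    simp only [hf, Complex.norm_real, Real.norm_eq_abs]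
  rwa [hft] at hnorm

/-- **The a-priori bound for `E_a` under a zero-free half-plane.** For every modulus `q ≥ 1`,
invertible residue `a` and `1/2 ≤ B < μ`: if every zero of every `L(·, χ)` (`χ mod q`) in
`0 < Re s < 1` has `Re s ≤ B`, then
`∑_{n ≡ a (q)} Λ(n) e^{-nt} − e^{-t}/(φ(q) t) = O(t^{-μ})` on `(0, 1]`
(for `B ≥ 1` the statement is unconditional, from Chebyshev's bound). This is the Laplace-side
form of the classical "`L(s, χ) ≠ 0` on `σ > B` for all `χ mod q` ⇒
`ψ(x; q, a) = x/φ(q) + O(x^{B+ε})`", obtained by Mellin inversion and a shift of contour with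
Borel–Carathéodory bounds for `L'/L`; it is the hypothesis of
`Literature.Barriers.Parity.BHMS2019_thm1_ii_of_laplaceBound`. [folklore] -/
theorem laplaceBound_of_zeroFree (q : ℕ) [NeZero q] (a : ZMod q) (ha : IsUnit a) (B μ : ℝ)
    (hB : 1 / 2 ≤ B) (hBμ : B < μ)
    (hzero : ∀ (χ : DirichletCharacter ℂ q) (s : ℂ), χ.LFunction s = 0 → 0 < s.re → s.re < 1 →
      s.re ≤ B) :
    ∃ K : ℝ, ∀ t : ℝ, 0 < t → t ≤ 1 →
      |laplaceSeries (residueClass a) t - Real.exp (-t) / ((q.totient : ℝ) * t)| ≤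
        K * t ^ (-μ) := by
  rcases lt_or_ge B 1 with hB1 | hB1
  · set μ' : ℝ := min μ 1 with hμ'
    have hBμ' : B < μ' := lt_min hBμ hB1
    have hμ'1 : μ' ≤ 1 := min_le_right _ _
    obtain ⟨K, hK0, hK⟩ := exists_norm_LFunctionResidueClassAux_le hB hBμ' hμ'1 hzero a
    refine ⟨1200 * K, fun t ht ht1 ↦ ?_⟩
    have h := abs_errLaplace_le_of_strip_bound ha hB hBμ' hμ'1 hK0 hzero hK ht ht1
    have hpow : t ^ (-μ') ≤ t ^ (-μ) :=
      Real.rpow_le_rpow_of_exponent_ge ht ht1 (by linarith [min_le_left μ 1])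
    calc _ ≤ 1200 * K * t ^ (-μ') := h
      _ ≤ 1200 * K * t ^ (-μ) := by gcongr
  · refine ⟨(Real.log 4 + 4) * geomWeightConst 1 + 1, fun t ht ht1 ↦ ?_⟩
    have h := abs_errLaplace_le_inv a ht ht1
    have hpow : t ^ (-(1 : ℝ)) ≤ t ^ (-μ) :=
      Real.rpow_le_rpow_of_exponent_ge ht ht1 (by linarith)
    have hK : 0 ≤ (Real.log 4 + 4) * geomWeightConst 1 + 1 := by
      have := geomWeightConst_nonneg 1; positivity
    exact h.trans (mul_le_mul_of_nonneg_left hpow hK)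

end Inversion

end LaplaceProgressions

end Literature.NumberTheory.LFunctions

end
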